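import Literature.AlgebraicGeometry.Motives.HodgeThetaSubalgebraUnitaryLeviFull
import HarnessLib

/-!
# The non-vanishing lemma on the LOWER Levi piece: a raising operator commuting with the Levi involution and
# non-zero on `U⁻` (Ribet 1983 Thm. 3, Lie step — a tool of the minimal-rank method)

Family `hodge`, layer `Literature/AlgebraicGeometry/Motives` (pure linear algebra over `ℂ`; no geometry). Research
context: cell `pub-hodge-ring2` (HONEST FRAMING: research route conditional on HC_CM; not a corollary; Q11.4-sentence-2
already refuted in dim ≥ 3), Literature lane gen 89. UNCONDITIONAL; theorems only, no definition, no named fact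
(D-0026), no `sorry`.

THE PRINT. K. A. Ribet, Amer. J. Math. 105 (1983), Thm. 3 = Gordon's survey Thm. 6.3 (3) [held
`paper:arxiv-alg-geom_9709030` p. 18]. THE TOOL. `UnitaryLeviFull.exists_raise_commute_apply_ne_zero` produces, for the
Levi involution `ι` of a raising operator `B` (pieces `U⁺ = PU ⊕ QU`, `U⁻ = B(W) ⊕ (Q ∩ ker B)`), a raising `X ∈ 𝔊`
commuting with `ι` and non-zero on `QU ⊆ U⁺` — i.e. of Levi profile `(i, j)` with `i ≠ 0`. Applied to the involution
`−ι ∈ 𝔊` (whose `+1`-eigenspace is `U⁻`) it produces one non-zero on `Q ∩ ker B ⊆ U⁻`, i.e. with `j ≠ 0`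
(**`UnitaryLeviFull.exists_raise_commute_apply_ne_zero_lower`**). The minimal-rank method
(`HodgeThetaSubalgebraUnitarySixteenTwentyOneCore` and its successors) uses the first as its non-vanishing lemma
(«every profile has `i = 0`» is absurd); the second gives the mirror endgame («every profile has `j = 0`» is absurd) and
seeds the raising-rank sub-family of `L⁻` without any hypothesis on the profiles with `i ≠ 0`.

## References
* [Ribet1983] K. A. Ribet, *Hodge classes on certain types of abelian varieties*, Amer. J. Math. 105 (1983), Thm. 3.
* [Gordon1997] B. B. Gordon, *A survey of the Hodge conjecture for abelian varieties*, Thm. 6.3 (3), pp. 18–19.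
* [Deligne1982HodgeCycles] P. Deligne, *Hodge cycles on abelian varieties*, LNM 900 (1982), I §3 Prop. 3.4, 3.6.
* [GoodmanWallachGTM255] R. Goodman, N. R. Wallach, GTM 255 (2009), §4.1.1.
-/

noncomputable section

open Module

namespace Literature.AlgebraicGeometry.Motives

namespace HodgeStructure

universe u

variable {W : Type u} [AddCommGroup W] [Module ℂ W]

/-- **Non-vanishing on the lower Levi piece.** For an involution `ι ∈ 𝔊` commuting with `Θ`, with eigenspaces
`U⁻ ∋` some non-zero `p` with `Θ p = p` and some non-zero `q` with `Θ q = −q`, there is a raising operator of `𝔊`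
commuting with `ι` and non-zero at some `q ∈ U⁻ ∩ Q` (the lemma `UnitaryLeviFull.exists_raise_commute_apply_ne_zero`
for `−ι`). [cite: Ribet1983, Thm. 3] [cite: Gordon1997, Thm. 6.3 (3)] [cite: Deligne1982HodgeCycles, I §3 Prop. 3.4, 3.6]
[cite: GoodmanWallachGTM255, §4.1.1] -/
theorem UnitaryLeviFull.exists_raise_commute_apply_ne_zero_lower [FiniteDimensional ℂ W]
    {𝔊 : Submodule ℂ (Module.End ℂ W)}
    (hbr : ∀ Y ∈ 𝔊, ∀ Z ∈ 𝔊, Y * Z - Z * Y ∈ 𝔊)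
    (hirr : ∀ U : Submodule ℂ W, (∀ A ∈ 𝔊, ∀ u ∈ U, A u ∈ U) → U = ⊥ ∨ U = ⊤)
    {Θ : Module.End ℂ W} (hΘ : Θ ∈ 𝔊) (hΘΘ : Θ * Θ = 1)
    {Q : Submodule ℂ W} (hQ : ∀ x, x ∈ Q ↔ Θ x = -x)
    {ι : Module.End ℂ W} (hι : ι ∈ 𝔊) (hιι : ι * ι = 1) (hιΘ : ι * Θ = Θ * ι)
    {Um Up : Submodule ℂ W} (hUm : ∀ x, x ∈ Um ↔ ι x = -x) (hUp : ∀ x, x ∈ Up ↔ ι x = x)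
    (hp : ∃ p, p ≠ 0 ∧ ι p = -p ∧ Θ p = p) (hq : ∃ q, q ≠ 0 ∧ ι q = -q ∧ Θ q = -q) :
    ∃ B' ∈ 𝔊, Θ * B' = B' ∧ B' * Θ = -B' ∧ B' * ι = ι * B' ∧ ∃ q, ι q = -q ∧ Θ q = -q ∧ B' q ≠ 0 := by
  have hnι : -ι ∈ 𝔊 := Submodule.neg_mem _ hι
  have hnιι : (-ι) * (-ι) = 1 := by rw [neg_mul_neg, hιι]
  have hnιΘ : (-ι) * Θ = Θ * (-ι) := by rw [neg_mul, mul_neg, hιΘ]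
  have hUp' : ∀ x, x ∈ Up ↔ (-ι) x = -x := fun x => by rw [LinearMap.neg_apply, neg_inj]; exact hUp x
  have hUm' : ∀ x, x ∈ Um ↔ (-ι) x = x := fun x => by rw [LinearMap.neg_apply, neg_eq_iff_eq_neg]; exact hUm x
  obtain ⟨p, hp0, hιp, hΘp⟩ := hp
  obtain ⟨q, hq0, hιq, hΘq⟩ := hq
  obtain ⟨B', hB', hΘB', hB'Θ, hB'c, q', hιq', hΘq', hB'q'⟩ :=
    UnitaryLeviFull.exists_raise_commute_apply_ne_zero hbr hirr hΘ hΘΘ hQ hnι hnιι hnιΘ hUp' hUm'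
      ⟨p, hp0, by rw [LinearMap.neg_apply, hιp, neg_neg], hΘp⟩
      ⟨q, hq0, by rw [LinearMap.neg_apply, hιq, neg_neg], hΘq⟩
  refine ⟨B', hB', hΘB', hB'Θ, ?_, q', ?_, hΘq', hB'q'⟩
  · have h := hB'c
    rw [mul_neg, neg_mul, neg_inj] at h
    exact h
  · rw [LinearMap.neg_apply, neg_eq_iff_eq_neg] at hιq'
    exact hιq'

end HodgeStructure

end Literature.AlgebraicGeometry.Motives

end
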